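import Summits.ResolutionOfSingularities.ResolutionOfSingularities.Theorems.HomologicalConductorNoZenoFrozenDivisor
import HarnessLib

/-!
# Crux `NoZenoR` (stmt-ResolutionOfSingularities-19943), slot `stub_shadowCapture3F` (v34): RESIDUAL VALUE DESCENT —
# a conductor chain of `O₁`-units with strictly decreasing `O`-values IS a chain of residues with strictly decreasing `Ō`-values

OURS (cell res-hironaka, crux chain W4.4; lead res-L0-w44-lead-1 g11, CHAIN v31 §2′ (c2) «type the chain-free form directly»).
AI-written, weaker than expert review; nothing here is a statement of the manuscript under review (Hironaka 2017).  SUPPORT-level,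
counted 0.  Def-free, fact-free.

The E3 / ShadowCapture3 residual of the composite slot (registry v34 `stub_shadowCapture3F`; tree `CompositeSplit.noChain_of_shadowCapture`,
`terminates_of_noChain`) is the non-existence of a CHAIN `z : ℕ → K` of `O₁`-units taken from late conductors with `z n · (z (n+1))⁻¹ ∈ O` and
`z (n+1) · (z n)⁻¹ ∉ O` for all `n` (`O < O₁` a proper coarsening).  By the frozen-divisor dictionary (`mul_inv_mem_iff_residue`, p591775)
the `O`-order between `O₁`-units IS the `Ō`-order of their residues, `Ō := residueValuationSubring O O₁`.  So:

* `valueStep_iff_residueStep` — one step of the chain, both clauses, in residue form;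
* `chain_iff_residueChain` — a sequence of non-zero `O₁`-units of `O` is an `O`-descending chain iff its residue sequence is an
  `Ō`-descending chain in `κ(O₁)`;
* `noChain_iff_noResidueChain` — at the conductor level (the `∃ m ≥ m₀, z n ∈ ca (tower O A m)` clause carried along): the slot's chain-free
  conclusion ⟺ «no sequence of late conductor elements that are `O₁`-units has residues with strictly decreasing `Ō`-values for ever».
READING: StrictDrop along `O` already speaks about these residues; what a closer of slot 5 must supply is a reason why the `Ō`-values of
RESIDUES OF CONDUCTOR ELEMENTS cannot descend for ever (a well-ordering / a noetherian ring containing them = ShadowCapture3), NOT a statement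
about `ca` of the shadow rings (known obstruction Q-shadow, CHAIN v31 §2′ (c)).
-/

noncomputable section

-- single-problem summit: the doubled namespace component `ResolutionOfSingularities` is forced
set_option linter.dupNamespace false

namespace Summit.ResolutionOfSingularities.ResolutionOfSingularities.Theorems.NoZeno.CompositeSplit

open Summit.ResolutionOfSingularities.ResolutionOfSingularities.Theses.HomologicalConductor
open Summit.ResolutionOfSingularities.ResolutionOfSingularities.Theorems.NoZeno.Birth
open Summit.ResolutionOfSingularities.ResolutionOfSingularities.Theorems
open Summit.ResolutionOfSingularities.ResolutionOfSingularities.Theorems.NoZeno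
open Literature.AlgebraicGeometry.Resolution
open IsLocalRing

variable {k K : Type} [Field k] [Field K] [Algebra k K]

/-- **One step, residue form.**  For non-zero `O₁`-units `x, y ∈ O`: «`x · y⁻¹ ∈ O` and `y · x⁻¹ ∉ O`» (the value of `y` is STRICTLY below
that of `x`) iff the same holds for the residues in `Ō = residueValuationSubring O O₁`. [this work; two applications of `mul_inv_mem_iff_residue`] -/
theorem valueStep_iff_residueStep (O O₁ : ValuationSubring K) (hO : O ≤ O₁) {x y : K} (hx : x ∈ O) (hy : y ∈ O)
    (hxi : x⁻¹ ∈ O₁) (hyi : y⁻¹ ∈ O₁) (hx0 : x ≠ 0) (hy0 : y ≠ 0) :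
    (x * y⁻¹ ∈ O ∧ y * x⁻¹ ∉ O) ↔
      (residue ↥O₁ ⟨x, hO hx⟩ * (residue ↥O₁ ⟨y, hO hy⟩)⁻¹ ∈ residueValuationSubring O O₁ hO ∧
        residue ↥O₁ ⟨y, hO hy⟩ * (residue ↥O₁ ⟨x, hO hx⟩)⁻¹ ∉ residueValuationSubring O O₁ hO) := by
  rw [mul_inv_mem_iff_residue O O₁ hO hy hx hyi hy0, mul_inv_mem_iff_residue O O₁ hO hx hy hxi hx0]

/-- **A sequence of non-zero `O₁`-units of `O` is an `O`-descending chain iff its residue sequence is an `Ō`-descending chain.** [this work] -/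
theorem chain_iff_residueChain (O O₁ : ValuationSubring K) (hO : O ≤ O₁) (z : ℕ → K) (hzO : ∀ n, z n ∈ O)
    (hz0 : ∀ n, z n ≠ 0) (hzi : ∀ n, (z n)⁻¹ ∈ O₁) :
    ((∀ n, z n * (z (n + 1))⁻¹ ∈ O) ∧ ∀ n, z (n + 1) * (z n)⁻¹ ∉ O) ↔
      ((∀ n, residue ↥O₁ ⟨z n, hO (hzO n)⟩ * (residue ↥O₁ ⟨z (n + 1), hO (hzO (n + 1))⟩)⁻¹ ∈
          residueValuationSubring O O₁ hO) ∧
        ∀ n, residue ↥O₁ ⟨z (n + 1), hO (hzO (n + 1))⟩ * (residue ↥O₁ ⟨z n, hO (hzO n)⟩)⁻¹ ∉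
          residueValuationSubring O O₁ hO) := by
  have h := fun n => valueStep_iff_residueStep O O₁ hO (hzO n) (hzO (n + 1)) (hzi n) (hzi (n + 1)) (hz0 n) (hz0 (n + 1))
  constructor
  · rintro ⟨h₁, h₂⟩
    exact ⟨fun n => ((h n).mp ⟨h₁ n, h₂ n⟩).1, fun n => ((h n).mp ⟨h₁ n, h₂ n⟩).2⟩
  · rintro ⟨h₁, h₂⟩
    exact ⟨fun n => ((h n).mpr ⟨h₁ n, h₂ n⟩).1, fun n => ((h n).mpr ⟨h₁ n, h₂ n⟩).2⟩

/-- **THE CHAIN-FREE CONCLUSION OF THE COMPOSITE SLOT IN RESIDUE FORM.**  For a coarsening `O ≤ O₁` and a threshold `m₀`: «no chain of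
non-zero `O₁`-units from the conductors `ca (T_m)`, `m ≥ m₀`, with strictly decreasing `O`-values» ⟺ «no such sequence whose RESIDUES in
`κ(O₁)` have strictly decreasing `Ō`-values» (stage elements lie in `O`, `mem_valuationSubring_of_mem_tower`). [this work] -/
theorem noChain_iff_noResidueChain (O O₁ : ValuationSubring K) (hO : O ≤ O₁) (A : Subalgebra k K)
    (hk : ∀ c : k, algebraMap k K c ∈ O) (hAO : A.toSubring ≤ O.toSubring) (m₀ : ℕ) :
    (¬ ∃ z : ℕ → K,
        (∀ n : ℕ, (∃ m : ℕ, m₀ ≤ m ∧ z n ∈ ca (tower O A m)) ∧ z n ≠ 0 ∧ (z n)⁻¹ ∈ O₁) ∧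
        (∀ n : ℕ, z n * (z (n + 1))⁻¹ ∈ O) ∧ ∀ n : ℕ, z (n + 1) * (z n)⁻¹ ∉ O) ↔
    ¬ ∃ (z : ℕ → K) (hzO : ∀ n, z n ∈ O),
        (∀ n : ℕ, (∃ m : ℕ, m₀ ≤ m ∧ z n ∈ ca (tower O A m)) ∧ z n ≠ 0 ∧ (z n)⁻¹ ∈ O₁) ∧
        (∀ n, residue ↥O₁ ⟨z n, hO (hzO n)⟩ * (residue ↥O₁ ⟨z (n + 1), hO (hzO (n + 1))⟩)⁻¹ ∈
            residueValuationSubring O O₁ hO) ∧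
        ∀ n, residue ↥O₁ ⟨z (n + 1), hO (hzO (n + 1))⟩ * (residue ↥O₁ ⟨z n, hO (hzO n)⟩)⁻¹ ∉
            residueValuationSubring O O₁ hO := by
  have hzO_of : ∀ z : ℕ → K, (∀ n : ℕ, (∃ m : ℕ, m₀ ≤ m ∧ z n ∈ ca (tower O A m)) ∧ z n ≠ 0 ∧ (z n)⁻¹ ∈ O₁) →
      ∀ n, z n ∈ O := fun z hz n => by
    obtain ⟨⟨m, -, hm⟩, -, -⟩ := hz n
    exact mem_valuationSubring_of_mem_tower O hk hAO m (z n) (ca_subset _ hm)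
  refine not_congr ⟨?_, ?_⟩
  · rintro ⟨z, hz, h₁, h₂⟩
    have hzO := hzO_of z hz
    obtain ⟨r₁, r₂⟩ := (chain_iff_residueChain O O₁ hO z hzO (fun n => (hz n).2.1) (fun n => (hz n).2.2)).mp ⟨h₁, h₂⟩
    exact ⟨z, hzO, hz, r₁, r₂⟩
  · rintro ⟨z, hzO, hz, r₁, r₂⟩
    obtain ⟨h₁, h₂⟩ := (chain_iff_residueChain O O₁ hO z hzO (fun n => (hz n).2.1) (fun n => (hz n).2.2)).mpr ⟨r₁, r₂⟩
    exact ⟨z, hz, h₁, h₂⟩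

end Summit.ResolutionOfSingularities.ResolutionOfSingularities.Theorems.NoZeno.CompositeSplit

end
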